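import Summits.HubbardSuperconductivity.HubbardSuperconductivity.Theorems.NodalWardXYVisonPairCostIRDefs

/-!
# Vocabulary of the symbol analysis of line `Sketch` for the crux `NodalWardXY.VisonPairCost`
# (stmt-HubbardSuperconductivity-1266) — part III of the `Defs`

Companion of `Theorems/NodalWardXYVisonPairCost{Defs,IRDefs}.lean`.  Cycle 4 of the lead: every stub of the infrared
chain has landed except `stub_symbolIntegralBounds : SymbolIntegralBounds` (the nodal analysis of the free `d`-wave BdG
symbol `symb`: `Φ₁(t) ≤ C(1+|log t|)`, `Φ₂(t) ≤ C/t` for the grid-line integrals `colPhi1/2`, `rowPhi1/2` on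
`t ∈ [1/L, t₀]`).  The lead reshapes it into

  `SymbDerivBounds → LineIntegralBounds → GridSumBounds → SymbolIntegralBounds`

over the following named quantities (definitions + `Prop`s only; the cone inequality `symbDen_ge_line`
is proved here):

* `coneSq Δ₀ = 8 min(1,Δ₀)²` — the cone constant: `ξ² + Δ̂² ≥ coneSq·((cos k₁ + μ/4)² + (cos k₂ + μ/4)²)`
  (`ξ = −2[(cos k₁ + μ/4) + (cos k₂ + μ/4)]`, `Δ̂ = 2Δ₀[(cos k₁ + μ/4) − (cos k₂ + μ/4)]`);
* `symbDen μ Δ₀ t k₁ k₂ = ξ² + Δ̂² + t²` — the denominator of `symb`;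
* `lineEps μ Δ₀ t k = √(coneSq·(cos k + μ/4)² + t²)` — the effective gap seen along the grid line through `k`;
* `SymbDerivBounds` — `‖∂ₛ symb‖ ≤ C/D`, `‖∂ₛ² symb‖ ≤ C(1/D + 1/(D√D))` (`D = symbDen`), and the `k₁ ↔ k₂` swap
  symmetry of these norms (entries are `(p cos s + q)/Q(cos s)` with `Q` quadratic, `Q ≥ t²`);
* `LineIntegralBounds` — `∫₀^{2π} dk/D(k,k₂) ≤ C/ε(k₂)` and `∫₀^{2π} dk/(D√D) ≤ C/ε(k₂)²` (fold to `[0,π]`, cone bound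
  `|cos k − cos n₀| ≥ κ|k − n₀|`, `n₀ = arccos(−μ/4) ∈ (0,π)`, then `arctan` / algebraic antiderivatives);
* `GridSumBounds` — `(1/L)Σⱼ 1/ε(2πj/L) ≤ C(1+|log t|)` and `(1/L)Σⱼ 1/ε² ≤ C/t` for `t ∈ [1/L, t₀]` (Riemann sum vs
  integral on the cells where `ε` is comparable, `O(1)` exceptional cells each `≤ 1/(tL) ≤ 1`; `arsinh` / `arctan`).
-/

noncomputable section

-- tree namespace Summit.HubbardSuperconductivity.HubbardSuperconductivity (D-0017)
set_option linter.dupNamespace false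

namespace Summit.HubbardSuperconductivity.HubbardSuperconductivity.Theorems.VisonPairCost

open Summit.HubbardSuperconductivity.HubbardSuperconductivity.Theses.NodalWardXY

/-- The cone constant `8 min(1,Δ₀)²`: `ξ² + Δ̂² ≥ coneSq Δ₀ · ((cos k₁ + μ/4)² + (cos k₂ + μ/4)²)`. -/
def coneSq (Δ₀ : ℝ) : ℝ := 8 * (min 1 Δ₀) ^ 2

/-- The denominator of the free symbol, `D(k₁,k₂) = ξ² + Δ̂² + t²`. -/
def symbDen (μ Δ₀ t k₁ k₂ : ℝ) : ℝ := xiS μ k₁ k₂ ^ 2 + gapS Δ₀ k₁ k₂ ^ 2 + t ^ 2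

/-- The effective gap along the grid line through the momentum `k` (in either direction):
`ε(k) = √(coneSq·(cos k + μ/4)² + t²)`, so that `D(k₁,k₂) ≥ coneSq·(cos k₁ + μ/4)² + ε(k₂)²`. -/
def lineEps (μ Δ₀ t k : ℝ) : ℝ := Real.sqrt (coneSq Δ₀ * (Real.cos k + μ / 4) ^ 2 + t ^ 2)

/-- (S-1) **Derivative bounds for the free symbol**: for `t > 0`, uniformly in the momenta and in `t`,
`‖∂ₛ symb(s,k₂)‖ ≤ C/D(s,k₂)` and `‖∂ₛ² symb(s,k₂)‖ ≤ C·(1/D + 1/(D√D))`, together with the swap symmetry of these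
norms under `k₁ ↔ k₂` (`symb(a,b)_{σσ'} = ± symb(b,a)_{σσ'}`, `D(a,b) = D(b,a)`). -/
def SymbDerivBounds : Prop :=
  ∀ (μ Δ₀ : ℝ), ∃ C : ℝ, 0 ≤ C ∧ ∀ t : ℝ, 0 < t → ∀ (k₁ k₂ : ℝ) (σ σ' : Fin 2),
    ‖deriv (fun s => symb μ Δ₀ t s k₂ σ σ') k₁‖ ≤ C / symbDen μ Δ₀ t k₁ k₂ ∧
    ‖iteratedDeriv 2 (fun s => symb μ Δ₀ t s k₂ σ σ') k₁‖ ≤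
        C * (1 / symbDen μ Δ₀ t k₁ k₂ + 1 / (symbDen μ Δ₀ t k₁ k₂ * Real.sqrt (symbDen μ Δ₀ t k₁ k₂))) ∧
    ‖deriv (fun s => symb μ Δ₀ t k₂ s σ σ') k₁‖ = ‖deriv (fun s => symb μ Δ₀ t s k₂ σ σ') k₁‖ ∧
    ‖iteratedDeriv 2 (fun s => symb μ Δ₀ t k₂ s σ σ') k₁‖ =
        ‖iteratedDeriv 2 (fun s => symb μ Δ₀ t s k₂ σ σ') k₁‖

/-- (S-2) **Line-integral bounds** (four conical nodes: `μ ∈ (−4,4)`, `Δ₀ > 0`): for `t > 0` and every `k₂`,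
`∫₀^{2π} dk/D(k,k₂) ≤ C/ε(k₂)` and `∫₀^{2π} dk/(D√D) ≤ C/ε(k₂)²`. -/
def LineIntegralBounds : Prop :=
  ∀ μ : ℝ, μ ∈ Set.Ioo (-4 : ℝ) 4 → ∀ Δ₀ : ℝ, 0 < Δ₀ → ∃ C : ℝ, 0 ≤ C ∧ ∀ t : ℝ, 0 < t → ∀ k₂ : ℝ,
    (∫ k in (0 : ℝ)..(2 * Real.pi), 1 / symbDen μ Δ₀ t k k₂) ≤ C / lineEps μ Δ₀ t k₂ ∧
    (∫ k in (0 : ℝ)..(2 * Real.pi), 1 / (symbDen μ Δ₀ t k k₂ * Real.sqrt (symbDen μ Δ₀ t k k₂))) ≤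
        C / lineEps μ Δ₀ t k₂ ^ 2

/-- (S-3) **Grid-sum bounds**: for `t ∈ [1/L, t₀]`, uniformly in `L ≥ 4`, `(1/L)Σⱼ 1/ε(2πj/L) ≤ C(1 + |log t|)` and
`(1/L)Σⱼ 1/ε(2πj/L)² ≤ C/t`. -/
def GridSumBounds : Prop :=
  ∀ μ : ℝ, μ ∈ Set.Ioo (-4 : ℝ) 4 → ∀ Δ₀ : ℝ, 0 < Δ₀ → ∀ t₀ : ℝ, 1 ≤ t₀ → ∃ C : ℝ, 0 ≤ C ∧
    ∀ (L : ℕ) [NeZero L], 4 ≤ L → ∀ t : ℝ, 1 / (L : ℝ) ≤ t → t ≤ t₀ →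
      (1 / (L : ℝ)) * ∑ j : Fin L, 1 / lineEps μ Δ₀ t (2 * Real.pi * (j : ℝ) / L) ≤ C * (1 + |Real.log t|) ∧
      (1 / (L : ℝ)) * ∑ j : Fin L, 1 / lineEps μ Δ₀ t (2 * Real.pi * (j : ℝ) / L) ^ 2 ≤ C / t

/-! ## The cone inequality (registered piece of the line-integral step, proved here) -/

/-- **Cone inequality** for the free `d`-wave symbol: `D(k₁,k₂) ≥ coneSq·(cos k₁ + μ/4)² + ε(k₂)²`, i.e.
`ξ² + Δ̂² ≥ 8 min(1,Δ₀)² ((cos k₁ + μ/4)² + (cos k₂ + μ/4)²)` (`Δ₀ ≥ 0`). Registered stub of the line. -/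
theorem symbDen_ge_line : ∀ (μ Δ₀ t k₁ k₂ : ℝ), 0 ≤ Δ₀ →
    coneSq Δ₀ * (Real.cos k₁ + μ / 4) ^ 2 + lineEps μ Δ₀ t k₂ ^ 2 ≤ symbDen μ Δ₀ t k₁ k₂ := by
  intro μ Δ₀ t k₁ k₂ hΔ
  have hnn : 0 ≤ coneSq Δ₀ * (Real.cos k₂ + μ / 4) ^ 2 + t ^ 2 := by unfold coneSq; positivity
  unfold lineEps
  rw [Real.sq_sqrt hnn]
  unfold symbDen xiS gapS coneSq
  set u := Real.cos k₁ + μ / 4 with hu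
  set w := Real.cos k₂ + μ / 4 with hw
  set m := min 1 Δ₀ with hm
  have hm0 : 0 ≤ m := le_min zero_le_one hΔ
  have hm1 : m ≤ 1 := min_le_left _ _
  have hmΔ : m ≤ Δ₀ := min_le_right _ _
  have hξ : -2 * Real.cos k₁ - 2 * Real.cos k₂ - μ = -2 * (u + w) := by rw [hu, hw]; ring
  have hΔ' : 2 * Δ₀ * (Real.cos k₁ - Real.cos k₂) = 2 * Δ₀ * (u - w) := by rw [hu, hw]; ring
  rw [hξ, hΔ']
  have h1 : m ^ 2 * (u + w) ^ 2 ≤ 1 * (u + w) ^ 2 :=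
    mul_le_mul_of_nonneg_right (by nlinarith) (sq_nonneg _)
  have h2 : m ^ 2 * (u - w) ^ 2 ≤ Δ₀ ^ 2 * (u - w) ^ 2 :=
    mul_le_mul_of_nonneg_right (by nlinarith) (sq_nonneg _)
  nlinarith [h1, h2, sq_nonneg (u + w), sq_nonneg (u - w), sq_nonneg t]

end Summit.HubbardSuperconductivity.HubbardSuperconductivity.Theorems.VisonPairCost

end
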